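import Mathlib
import HarnessLib

/-!
# Crux `BirComplexStableXYR`, line `fat-gaussian-defect-calculus`: stub T12 `stub_feshbachConjOfJ`

Registered stub (lead c8, wave 14, chapter T-end, skeleton
`Cruxes/BirComplexStableXYR/Lines/fat_gaussian_defect_calculus.lean`), helper (`--supports`) for the crux
`Summit.HubbardSuperconductivity.HubbardSuperconductivity.Theses.BalabanIR.BirComplexStableXYR`:
**a conjugation symmetry of the chain makes the Feshbach map conj-covariant** (the hypothesis of T8,
`stub_muReal`).  Generic functional analysis over a complex normed space `E`; pure algebra in the ring
`E →L[ℂ] E` of bounded operators, no project definition is used.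

**Statement.** Let `t : E →L[ℂ] E`, `e : E`, `φ : E →L[ℂ] ℂ`, and let `J : E →L⋆[ℂ] E` be a continuous
conjugate-linear map with `J e = e`, `φ ∘ J = conj ∘ φ` and `J ∘ t = t ∘ J`.  With the rank-one map
`p₀ := φ(·)e = φ.smulRight e`, `q₀ := 1 − p₀`, the complement block `M := q₀ t q₀`, the row functional
`b := φ ∘ t ∘ q₀`, the column `c := q₀ (t e)`, `a := φ (t e)` and the resolvents `R(z) := (z − M)⁻¹`
(`Ring.inverse`; both `z − M` and `z̄ − M` are assumed to be units), the Feshbach map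
`G(z) := a + b (R(z) c)` satisfies `G(z̄) = conj (G(z))`.

**Proof.** (1) `J` commutes with `p₀` (`J (φ y • e) = conj (φ y) • J e = φ (J y) • e`), hence with `q₀` and with
`M` (using `J t = t J` in the middle).  (2) `J c = q₀ (t (J e)) = c`.  (3) `b (J y) = φ (J (t (q₀ y))) = conj (b y)`.
(4) `conj a = φ (J (t e)) = a`.  (5) Resolvent intertwining `J (R(z) y) = R(z̄) (J y)`: from `(z − M) R(z) = 1`
evaluated at `y` and conjugate-linearity, `(z̄ − M) (J (R(z) y)) = J y`; apply `R(z̄)` and use `R(z̄) (z̄ − M) = 1`.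
(6) Assemble: `conj (G z) = a + b (J (R(z) c)) = a + b (R(z̄) (J c)) = a + b (R(z̄) c) = G(z̄)`.
The algebra is isolated in `hsc_conjJ_resolvent_core` / `hsc_conjJ_core`, stated for opaque `q₀, R, R'` with their
defining equations, and the registered signature follows by `Ring.mul_inverse_cancel` / `Ring.inverse_mul_cancel`.
Mathlib only; no definition and no named fact is introduced; sorry-free. [folklore]
-/

set_option linter.dupNamespace false -- `Summit.<S>.<S>.Theorems…` repeats the summit name (D-0017 layout)

namespace Summit.HubbardSuperconductivity.HubbardSuperconductivity.Theorems.TEnd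

open scoped ComplexConjugate

section Core

variable {E : Type*} [NormedAddCommGroup E] [NormedSpace ℂ E]

/-- **Resolvent intertwining by a conjugate-linear symmetry.**  If a continuous conjugate-linear `J` commutes
with `M`, `R` is a right inverse of `z • 1 − M` and `R'` a left inverse of `z̄ • 1 − M`, then `J (R y) = R' (J y)`
for every `y` (apply `J` to `(z − M) (R y) = y`, then `R'` on the left). [folklore] -/
theorem hsc_conjJ_resolvent_core (M R R' : E →L[ℂ] E) (J : E →L⋆[ℂ] E)
    (hJM : ∀ y : E, J (M y) = M (J y)) {z : ℂ} (hR : (z • (1 : E →L[ℂ] E) - M) * R = 1)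
    (hR' : R' * (conj z • (1 : E →L[ℂ] E) - M) = 1) (y : E) : J (R y) = R' (J y) := by
  -- `(z − M) R = 1` evaluated at `y`
  have h1 : z • R y - M (R y) = y := by
    have h := congrArg (fun f : E →L[ℂ] E => f y) hR
    simpa using h
  -- `R' (z̄ − M) = 1` evaluated at `J (R y)`
  have h2 : R' (conj z • J (R y) - M (J (R y))) = J (R y) := by
    have h := congrArg (fun f : E →L[ℂ] E => f (J (R y))) hR'
    simpa using h
  -- apply the conjugate-linear `J` to `h1`
  have h3 : conj z • J (R y) - M (J (R y)) = J y := by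
    have h := congrArg J h1
    rwa [map_sub, map_smulₛₗ, hJM] at h
  rw [h3] at h2
  exact h2.symm

/-- **Core algebra of the conj-covariance of the Feshbach map.**  For opaque `q₀ = 1 − φ(·)e`, a right inverse
`R` of `z • 1 − q₀ t q₀` and a left inverse `R'` of `z̄ • 1 − q₀ t q₀`, and a continuous conjugate-linear `J` with
`J e = e`, `φ ∘ J = conj ∘ φ`, `J ∘ t = t ∘ J`:
`φ (t e) + (φ ∘ t ∘ q₀) (R' (q₀ (t e))) = conj (φ (t e) + (φ ∘ t ∘ q₀) (R (q₀ (t e))))`. [folklore] -/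
theorem hsc_conjJ_core (t : E →L[ℂ] E) (e : E) (φ : E →L[ℂ] ℂ) (J : E →L⋆[ℂ] E) (hJe : J e = e)
    (hJφ : ∀ y : E, φ (J y) = conj (φ y)) (hJt : ∀ y : E, J (t y) = t (J y))
    (q₀ : E →L[ℂ] E) (hq : q₀ = (1 : E →L[ℂ] E) - φ.smulRight e) {z : ℂ} (R R' : E →L[ℂ] E)
    (hR : (z • (1 : E →L[ℂ] E) - q₀ * t * q₀) * R = 1)
    (hR' : R' * (conj z • (1 : E →L[ℂ] E) - q₀ * t * q₀) = 1) :
    φ (t e) + (φ.comp (t * q₀)) (R' (q₀ (t e))) = conj (φ (t e) + (φ.comp (t * q₀)) (R (q₀ (t e)))) := by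
  -- (1) `J` commutes with `q₀` and with `M = q₀ t q₀`
  have hq₀y : ∀ y, q₀ y = y - φ y • e := fun y => by
    simp [hq, ContinuousLinearMap.smulRight_apply]
  have hJq : ∀ y, J (q₀ y) = q₀ (J y) := fun y => by
    rw [hq₀y, hq₀y, map_sub, map_smulₛₗ, hJe, hJφ]
  have hJM : ∀ y, J ((q₀ * t * q₀) y) = (q₀ * t * q₀) (J y) := fun y => by
    simp only [mul_apply_eq_comp]
    rw [hJq, hJt, hJq]
  -- (2) `J c = c`
  have hJc : J (q₀ (t e)) = q₀ (t e) := by rw [hJq, hJt, hJe]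
  -- (3) `b (J y) = conj (b y)`
  have hb : ∀ y, (φ.comp (t * q₀)) (J y) = conj ((φ.comp (t * q₀)) y) := fun y => by
    simp only [ContinuousLinearMap.comp_apply, mul_apply_eq_comp]
    rw [← hJq, ← hJt, hJφ]
  -- (4) `conj a = a`
  have ha : conj (φ (t e)) = φ (t e) := by rw [← hJφ, hJt, hJe]
  -- (5) resolvent intertwining
  have hJR : J (R (q₀ (t e))) = R' (J (q₀ (t e))) :=
    hsc_conjJ_resolvent_core (q₀ * t * q₀) R R' J hJM hR hR' _
  -- (6) assemble
  rw [map_add, ha, ← hb, hJR, hJc]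

end Core

/-- **stub T12 (M, generic): a conjugation symmetry of the chain makes the Feshbach map conj-covariant** (the
hypothesis of T8).  If a continuous conjugate-linear `J` fixes `e`, intertwines `φ` with complex conjugation and
commutes with `t`, then `J` commutes with `p₀ = φ(·)e`, `q₀`, `M = q₀tq₀`, fixes `c = q₀te`, satisfies `b∘J = conj∘b`
for `b = φ∘t∘q₀`, and `J R(z) = R(z̄) J` for the resolvents; hence `G(z̄) = conj G(z)` for the Feshbach map
`G(z) = φ(te) + b R(z) c`.  Reduced to `hsc_conjJ_core` via `Ring.mul_inverse_cancel` / `Ring.inverse_mul_cancel`.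
[folklore] -/
theorem stub_feshbachConjOfJ :
    ∀ (E : Type) [NormedAddCommGroup E] [NormedSpace ℂ E] (t : E →L[ℂ] E) (e : E) (φ : E →L[ℂ] ℂ) (J : E →L⋆[ℂ] E),
      J e = e → (∀ y : E, φ (J y) = (starRingEnd ℂ) (φ y)) → (∀ y : E, J (t y) = t (J y)) →
      ∀ z : ℂ,
        IsUnit (z • (1 : E →L[ℂ] E) - ((1 : E →L[ℂ] E) - φ.smulRight e) * t * ((1 : E →L[ℂ] E) - φ.smulRight e)) →
        IsUnit ((starRingEnd ℂ) z • (1 : E →L[ℂ] E) - ((1 : E →L[ℂ] E) - φ.smulRight e) * t * ((1 : E →L[ℂ] E) - φ.smulRight e)) →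
        φ (t e) + (φ.comp (t * ((1 : E →L[ℂ] E) - φ.smulRight e)))
          (Ring.inverse ((starRingEnd ℂ) z • (1 : E →L[ℂ] E) - ((1 : E →L[ℂ] E) - φ.smulRight e) * t * ((1 : E →L[ℂ] E) - φ.smulRight e))
            (((1 : E →L[ℂ] E) - φ.smulRight e) (t e))) =
        (starRingEnd ℂ) (φ (t e) + (φ.comp (t * ((1 : E →L[ℂ] E) - φ.smulRight e)))
          (Ring.inverse (z • (1 : E →L[ℂ] E) - ((1 : E →L[ℂ] E) - φ.smulRight e) * t * ((1 : E →L[ℂ] E) - φ.smulRight e))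
            (((1 : E →L[ℂ] E) - φ.smulRight e) (t e)))) := by
  intro E _ _ t e φ J hJe hJφ hJt z hU hU'
  exact hsc_conjJ_core t e φ J hJe hJφ hJt ((1 : E →L[ℂ] E) - φ.smulRight e) rfl
    (Ring.inverse (z • (1 : E →L[ℂ] E) - ((1 : E →L[ℂ] E) - φ.smulRight e) * t * ((1 : E →L[ℂ] E) - φ.smulRight e)))
    (Ring.inverse ((starRingEnd ℂ) z • (1 : E →L[ℂ] E) -
      ((1 : E →L[ℂ] E) - φ.smulRight e) * t * ((1 : E →L[ℂ] E) - φ.smulRight e)))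
    (Ring.mul_inverse_cancel _ hU) (Ring.inverse_mul_cancel _ hU')

end Summit.HubbardSuperconductivity.HubbardSuperconductivity.Theorems.TEnd
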